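import Literature.NumberTheory.GaloisRepresentations.PrimaryGeneratorHeckeCharacter
import Literature.NumberTheory.GaloisRepresentations.CMTypeHeckeCharacter
import Literature.NumberTheory.NumberFields.RayClassFieldAdicCharacterTower
import Literature.NumberTheory.NumberFields.RayClassFieldSplitPrimePowerDegreeQuadratic
import Literature.NumberTheory.LocalFields.PadicRootsOfUnity
import HarnessLib

/-!
# Uniqueness of the `j = 0` Katz–de Shalit measure on `Γ_K`, IV: ONE Hecke character of type `(−1, 0)`
# unramified off `v̄`, from the primary generators modulo `v̄²` (Ireland–Rosen 18 §4; de Shalit 1987 II.1.9)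

Cell `bsd-print-cf2`, width seat `bsd-line-cf2-p1-w5` g15; sequel of `…KatzJZeroUniqueSupply.lean` (III),
which reduced the auxiliary data of the `j = 0` uniqueness theorem to ONE Hecke character `φ₀` of type
`(−1, 0)` unramified at every `w ≠ v̄`. THIS file constructs it when `𝓞_K` is principal with `#𝓞_K^× = 2`,
`v̄` a place with `𝒪_{v̄} ≅ ℤ₂` and `2 ∉ v̄²` — the lane's `K = ℚ(√−7)`, `2 = v v̄` — from the tree's
`exists_heckeCharacter_primaryGen` (the "primary generator" Grössencharakter `(α) ↦ σ_{w₀}(α)`, `α ≡ 1 mod 𝔣`)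
at the modulus `𝔣 = v̄²`:

* §1 `eq_one_or_eq_neg_one_of_isUnit_zmod_four`, `valued_algebraMap_ringOfIntegers`,
  ★ `sub_one_mem_sq_or_neg_sub_one_mem_sq` — for `x ∉ v̄`: `x ≡ 1` or `−x ≡ 1 (mod v̄²)` (read `x` in
  `𝒪_{v̄} ≅ ℤ₂`: a `2`-adic unit is `≡ ±1 (mod 4)`), whence the surjectivity hypothesis `hsurj` of the
  primary-generator construction at `𝔣 = v̄²` (`exists_unit_mul_sub_one_mem_sq`); the injectivity `hinj`
  is the tree's `units_eq_one_of_sub_one_mem_of_natCard_eq_two` (`−1 ≢ 1 (mod v̄²)` as `2 ∉ v̄²`);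
* §2 `embType_eq_of_forall_eq` / `embTypeConj_eq_of_forall_eq` — with ONE infinite place `w₀` the type of
  `(α) ↦ σ_{w₀}(α)` is `(1, 0)`; ★★ `exists_char_type_neg_one` — **there is a Hecke character `φ₀` of type
  `(−1, 0)` unramified at every `w ≠ v̄`** (the inverse of the primary-generator character).

Theorems only; no `sorry`; nothing is closed by this file; no summit statement is proved; BSD is not proved
by any of this.

## References

* [IrelandRosen1982] K. Ireland, M. Rosen, *A Classical Introduction to Modern Number Theory*, Ch. 18 §4.
* [deShalit1987] E. de Shalit, *Iwasawa theory of elliptic curves with complex multiplication* (1987), II.1.9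
  (p. 43), II.4.12 (p. 66–67).
* [Weil1956] A. Weil, *On a certain type of characters of the idèle-class group*, §1.
-/

noncomputable section

namespace Summit.BirchSwinnertonDyer.BirchSwinnertonDyer.Theorems.PrintCf2.KatzJZeroUnique

open scoped NumberField Classical
open NumberField IsDedekindDomain IsDedekindDomain.HeightOneSpectrum Field
open Literature.NumberTheory.GaloisRepresentations Literature.NumberTheory.NumberFields

set_option linter.dupNamespace false -- D-0017: single-problem summit, `…BirchSwinnertonDyer.BirchSwinnertonDyer…` repeats a namespace by design
set_option autoImplicit false

variable {K : Type} [Field K] [NumberField K]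

/-! ### §1. Residues modulo `v̄²` at a place with `𝒪_{v̄} ≅ ℤ₂` -/

/-- The units of `ℤ/4` are `±1`. [folklore] -/
theorem eq_one_or_eq_neg_one_of_isUnit_zmod_four (z : ZMod (2 ^ 2)) (hz : IsUnit z) : z = 1 ∨ z = -1 := by
  fin_cases z
  · exact absurd hz (by decide)
  · exact Or.inl rfl
  · exfalso
    obtain ⟨u, hu⟩ := hz
    have h := u.mul_inv
    have key : ∀ a : ZMod (2 ^ 2), (2 : ZMod (2 ^ 2)) * a ≠ 1 := by decide
    exact key _ (by rw [← h, hu]; rfl)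
  · exact Or.inr rfl

/-- The `v`-adic valuation of an algebraic integer read in `𝒪_v`. [folklore] -/
theorem valued_algebraMap_ringOfIntegers (v : HeightOneSpectrum (𝓞 K)) (x : 𝓞 K) :
    Valued.v ((algebraMap (𝓞 K) (v.adicCompletionIntegers K) x : v.adicCompletion K)) = v.intValuation x := by
  rw [IsDedekindDomain.HeightOneSpectrum.algebraMap_adicCompletionIntegers_apply,
    valuedAdicCompletion_eq_valuation', valuation_of_algebraMap]

/-- ★ **A `v̄`-unit is `≡ ±1 (mod v̄²)` when `𝒪_{v̄} ≅ ℤ₂`**: for `x ∉ v̄`, `x − 1 ∈ v̄²` or `−x − 1 ∈ v̄²` (a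
`2`-adic unit is `≡ 1` or `3 (mod 4)`). [cite: deShalit1987, II.1.9 (p. 43)] [cite: IrelandRosen1982, Ch. 18 §4] -/
theorem sub_one_mem_sq_or_neg_sub_one_mem_sq {vbar : HeightOneSpectrum (𝓞 K)}
    (e : vbar.adicCompletionIntegers K ≃+* ℤ_[2]) {x : 𝓞 K} (hx : x ∉ vbar.asIdeal) :
    x - 1 ∈ vbar.asIdeal ^ 2 ∨ -x - 1 ∈ vbar.asIdeal ^ 2 := by
  set r : vbar.adicCompletionIntegers K := algebraMap (𝓞 K) (vbar.adicCompletionIntegers K) x with hr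
  have hval : Valued.v (r : vbar.adicCompletion K) = 1 := by
    rw [hr, valued_algebraMap_ringOfIntegers, intValuation_eq_one_iff]
    exact hx
  have hunit : IsUnit r := adicCompletionIntegers.isUnit_iff_valued_eq_one.mpr hval
  have hz : IsUnit (PadicInt.toZModPow 2 (e r)) := (hunit.map e).map _
  -- reading a congruence `y ≡ 1 (mod 4)` in `ℤ₂` back in `𝓞_K`
  have back : ∀ y : 𝓞 K, PadicInt.toZModPow 2 (e (algebraMap (𝓞 K) (vbar.adicCompletionIntegers K) y)) = 1 →
      y - 1 ∈ vbar.asIdeal ^ 2 := by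
    intro y hy
    have h1 := (toZModPow_map_eq_one_iff_valued e 2 _).mp hy
    rw [← intValuation_le_pow_iff_mem, ← valued_algebraMap_ringOfIntegers vbar (y - 1)]
    rw [map_sub, map_one, AddSubgroupClass.coe_sub, OneMemClass.coe_one]
    exact_mod_cast h1
  rcases eq_one_or_eq_neg_one_of_isUnit_zmod_four _ hz with h | h
  · exact Or.inl (back x h)
  · refine Or.inr (back (-x) ?_)
    rw [map_neg, map_neg, map_neg, h, neg_neg]

/-- **Every residue class prime to `v̄²` contains a unit** (`𝒪_{v̄} ≅ ℤ₂`): the surjectivity hypothesis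
`hsurj` of `exists_heckeCharacter_primaryGen` at `𝔣 = v̄²`, with the unit `±1`.
[cite: IrelandRosen1982, Ch. 18 §4] [cite: deShalit1987, II.1.9 (p. 43)] -/
theorem exists_unit_mul_sub_one_mem_sq {vbar : HeightOneSpectrum (𝓞 K)}
    (e : vbar.adicCompletionIntegers K ≃+* ℤ_[2]) (x : 𝓞 K) (hx : IsCoprime (Ideal.span {x}) (vbar.asIdeal ^ 2)) :
    ∃ u : (𝓞 K)ˣ, (u : 𝓞 K) * x - 1 ∈ vbar.asIdeal ^ 2 := by
  have hx' : x ∉ vbar.asIdeal := by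
    intro h
    have h1 : Ideal.span {x} ≤ vbar.asIdeal := (Ideal.span_singleton_le_iff_mem _).mpr h
    have h2 : vbar.asIdeal ^ 2 ≤ vbar.asIdeal := Ideal.pow_le_self two_ne_zero
    have htop := Ideal.isCoprime_iff_sup_eq.mp hx
    exact vbar.isPrime.ne_top (top_le_iff.mp (htop ▸ sup_le h1 h2))
  rcases sub_one_mem_sq_or_neg_sub_one_mem_sq e hx' with h | h
  · exact ⟨1, by rwa [Units.val_one, one_mul]⟩
  · exact ⟨-1, by rwa [Units.val_neg, Units.val_one, neg_one_mul]⟩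

/-- **`2 ∉ v̄²` at a split `2`**: if `v·v̄ ⊆ (2)` with `v̄ ≠ v` then `2 ∉ v̄²` (else `v̄² ∣ (2) ∣ v·v̄`, so `v̄ ∣ v`).
[cite: deShalit1987, II.1.9 (p. 43)] -/
theorem two_not_mem_sq_of_split {v vbar : HeightOneSpectrum (𝓞 K)} (hne : vbar ≠ v)
    (hp2 : v.asIdeal * vbar.asIdeal ≤ Ideal.span {((2 : ℕ) : 𝓞 K)}) : (2 : 𝓞 K) ∉ vbar.asIdeal ^ 2 := by
  intro h2
  have h1 : vbar.asIdeal ^ 2 ∣ Ideal.span {((2 : ℕ) : 𝓞 K)} := by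
    rw [Ideal.dvd_iff_le, Ideal.span_singleton_le_iff_mem, Nat.cast_ofNat]
    exact h2
  have h3 : vbar.asIdeal ^ 2 ∣ v.asIdeal * vbar.asIdeal := h1.trans (Ideal.dvd_iff_le.mpr hp2)
  rw [sq, mul_comm v.asIdeal, mul_dvd_mul_iff_left vbar.ne_bot, Ideal.dvd_iff_le] at h3
  exact hne (HeightOneSpectrum.ext (v.isMaximal.eq_of_le vbar.isPrime.ne_top h3)).symm

/-! ### §1b. A unit `≡ 1 (mod v̄²)` is `1` when `𝒪_{v̄} ≅ ℤ₂` and `K` has ONE infinite place -/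

/-- With one infinite place every unit of `𝓞 K` has finite order (`r₁ + r₂ − 1 = 0`: the relation
`∑_w mult(w)·log w(u) = 0` has a single term, so `w₀(u) = 1`). [cite: NeukirchANT1999, Ch. I §7 (7.4)] -/
theorem isOfFinOrder_units_of_forall_eq {w₀ : InfinitePlace K} (hw₀ : ∀ w : InfinitePlace K, w = w₀)
    (u : (𝓞 K)ˣ) : IsOfFinOrder u := by
  have h := NumberField.Units.sum_mult_mul_log u
  have huniv : (Finset.univ : Finset (InfinitePlace K)) = {w₀} :=
    Finset.eq_singleton_iff_unique_mem.2 ⟨Finset.mem_univ _, fun w _ ↦ hw₀ w⟩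
  rw [huniv, Finset.sum_singleton] at h
  have hlog : Real.log (w₀ (u : K)) = 0 := by
    rcases mul_eq_zero.mp h with h | h
    · exact absurd h (by exact_mod_cast InfinitePlace.mult_ne_zero)
    · exact h
  have h1 : w₀ (u : K) = 1 :=
    Real.eq_one_of_pos_of_log_eq_zero (NumberField.Units.pos_at_place u w₀) hlog
  have ht : u ∈ NumberField.Units.torsion K :=
    (NumberField.Units.mem_torsion K).mpr fun w ↦ by rw [hw₀ w]; exact h1
  rw [NumberField.Units.torsion] at ht
  exact (CommGroup.mem_torsion _).mp ht

/-- `‖ζ^k − 1‖ ≤ ‖ζ − 1‖` in `ℤ_p` (`ζ − 1 ∣ ζ^k − 1`). [folklore] -/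
theorem padicInt_norm_pow_sub_one_le {p : ℕ} [Fact p.Prime] (ζ : ℤ_[p]) (k : ℕ) : ‖ζ ^ k - 1‖ ≤ ‖ζ - 1‖ := by
  obtain ⟨c, hc⟩ := sub_dvd_pow_sub_pow ζ 1 k
  rw [one_pow] at hc
  rw [hc, norm_mul]
  exact mul_le_of_le_one_right (norm_nonneg _) (PadicInt.norm_le_one c)

/-- **A `2`-power root of unity `≡ 1 (mod 4)` in `ℤ₂` is `1`** (`η² = 1 ⟹ η = ±1`, and `‖−1 − 1‖₂ = ½`).
[cite: Serre1973, Ch. II §3.1 Prop. 7, §3.2] -/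
theorem padicInt_eq_one_of_pow_two_pow_eq_one {ζ : ℤ_[2]} (h1 : ‖ζ - 1‖ < 2⁻¹) :
    ∀ {a : ℕ}, ζ ^ 2 ^ a = 1 → ζ = 1 := by
  intro a
  induction a with
  | zero => intro h; rwa [pow_zero, pow_one] at h
  | succ a ih =>
    intro h
    apply ih
    have hη : ζ ^ 2 ^ a * ζ ^ 2 ^ a = 1 := by rw [← pow_add, ← two_mul, ← pow_succ', h]
    rcases mul_self_eq_one_iff.mp hη with h' | h'
    · exact h'
    · exfalso
      have hle := (padicInt_norm_pow_sub_one_le ζ (2 ^ a)).trans_lt h1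
      rw [h', show (-1 - 1 : ℤ_[2]) = -2 by norm_num, norm_neg] at hle
      have h2 : ‖(2 : ℤ_[2])‖ = 2⁻¹ := by
        have h2' := PadicInt.norm_p (p := 2)
        exact_mod_cast h2'
      rw [h2] at hle
      exact lt_irrefl _ hle

/-- ★ **A torsion element of `1 + 4ℤ₂` is trivial** (`ℤ₂^× = {±1} × (1 + 4ℤ₂)`, `1 + 4ℤ₂ ≅ ℤ₂` torsion-free):
kill the `2`-part by `padicInt_eq_one_of_pow_two_pow_eq_one`, the odd part by Serre's `V ∩ U₁ = 1`.
[cite: Serre1973, Ch. II §3.1 Prop. 7, §3.2 Prop. 8] -/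
theorem padicInt_eq_one_of_isOfFinOrder {x : ℤ_[2]} (hx : IsOfFinOrder x) (h1 : ‖x - 1‖ < 2⁻¹) : x = 1 := by
  obtain ⟨n, hn, hxn⟩ := isOfFinOrder_iff_pow_eq_one.mp hx
  obtain ⟨k, m, hm, rfl⟩ := Nat.exists_eq_two_pow_mul_odd hn.ne'
  have hy : (x ^ m) ^ 2 ^ k = 1 := by rw [← pow_mul, mul_comm, hxn]
  have hym : x ^ m = 1 :=
    padicInt_eq_one_of_pow_two_pow_eq_one ((padicInt_norm_pow_sub_one_le x m).trans_lt h1) hy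
  exact Literature.NumberTheory.LocalFields.padicInt_eq_one_of_pow_eq_one_of_norm_sub_one_lt (p := 2)
    (Nat.two_dvd_ne_zero.mpr (Nat.odd_iff.mp hm)) hym (h1.trans (by norm_num))

/-- ★★ **A unit `≡ 1 (mod v̄²)` is `1`** when `𝒪_{v̄} ≅ ℤ₂` and `K` has one infinite place: its image in
`ℤ₂` is a torsion element of `1 + 4ℤ₂`, hence `1`, and `𝓞_K → 𝒪_{v̄}` is injective — the hypothesis
`hinj`/`hw` of the primary-generator character and of the cell lemmas at `𝔣 = v̄²`, with NO appeal to
`#𝓞_K^× = 2` or `2 ∉ v̄²`. [cite: deShalit1987, II.1.9 (p. 43)] [cite: Serre1973, Ch. II §3.2 Prop. 8] -/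
theorem units_eq_one_of_sub_one_mem_sq {vbar : HeightOneSpectrum (𝓞 K)}
    (e : vbar.adicCompletionIntegers K ≃+* ℤ_[2]) {w₀ : InfinitePlace K}
    (hw₀ : ∀ w : InfinitePlace K, w = w₀) (u : (𝓞 K)ˣ) (hu : (u : 𝓞 K) - 1 ∈ vbar.asIdeal ^ 2) :
    u = 1 := by
  set r : vbar.adicCompletionIntegers K := algebraMap (𝓞 K) (vbar.adicCompletionIntegers K) (u : 𝓞 K)
    with hr
  -- `e r ≡ 1 (mod 4)`, i.e. `‖e r − 1‖ ≤ ¼`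
  have hval : Valued.v ((r : vbar.adicCompletion K) - 1) ≤ WithZero.exp (-((2 : ℕ) : ℤ)) := by
    have h := hu
    rw [← intValuation_le_pow_iff_mem, ← valued_algebraMap_ringOfIntegers vbar ((u : 𝓞 K) - 1), map_sub,
      map_one, AddSubgroupClass.coe_sub, OneMemClass.coe_one] at h
    exact_mod_cast h
  have h4 : PadicInt.toZModPow 2 (e r) = 1 := (toZModPow_map_eq_one_iff_valued e 2 r).mpr hval
  have hnorm : ‖e r - 1‖ < 2⁻¹ := by
    have hmem : e r - 1 ∈ (Ideal.span {((2 : ℕ) : ℤ_[2]) ^ 2} : Ideal ℤ_[2]) := by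
      rw [← PadicInt.ker_toZModPow, RingHom.mem_ker, map_sub, h4, map_one, sub_self]
    have hle : ‖e r - 1‖ ≤ ((2 : ℕ) : ℝ) ^ (-(2 : ℕ) : ℤ) := (PadicInt.norm_le_pow_iff_mem_span_pow _ 2).mpr hmem
    exact hle.trans_lt (by norm_num)
  -- the image of a unit of finite order is torsion, hence `e r = 1`
  have hfin : IsOfFinOrder (e r) :=
    ((e : vbar.adicCompletionIntegers K →+* ℤ_[2]).toMonoidHom.comp
      ((algebraMap (𝓞 K) (vbar.adicCompletionIntegers K)).toMonoidHom.comp (Units.coeHom (𝓞 K)))).isOfFinOrder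
      (isOfFinOrder_units_of_forall_eq hw₀ u)
  have her : e r = 1 := padicInt_eq_one_of_isOfFinOrder hfin hnorm
  have hr1 : r = 1 := e.injective (by rw [her, map_one])
  -- `𝓞 K → 𝒪_{v̄}` is injective
  have h1 : (u : 𝓞 K) = 1 :=
    FaithfulSMul.algebraMap_injective (𝓞 K) (vbar.adicCompletionIntegers K) (by rw [← hr, hr1, map_one])
  exact Units.ext h1

/-! ### §2. The character of type `(−1, 0)` unramified off `v̄` -/

omit [NumberField K] in
/-- With one infinite place `w₀`, the type of `(α) ↦ σ_{w₀}(α)` has `p = 1`. [cite: Weil1956, §1] -/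
theorem embType_eq_of_forall_eq {w₀ : InfinitePlace K} (hw₀ : ∀ w : InfinitePlace K, w = w₀) :
    embType w₀.embedding = fun _ ↦ (1 : ℤ) := by
  funext w
  rw [hw₀ w, embType, if_pos rfl]

omit [NumberField K] in
/-- With one infinite place `w₀`, the type of `(α) ↦ σ_{w₀}(α)` has `q = 0`. [cite: Weil1956, §1] -/
theorem embTypeConj_eq_of_forall_eq {w₀ : InfinitePlace K} (hw₀ : ∀ w : InfinitePlace K, w = w₀) :
    embTypeConj w₀.embedding = fun _ ↦ (0 : ℤ) := by
  funext w
  rw [hw₀ w, embTypeConj, if_pos rfl]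

/-- ★★ **A Hecke character of type `(−1, 0)` unramified off `v̄`** exists when `𝓞_K` is principal,
`𝒪_{v̄} ≅ ℤ₂` and `K` has one infinite place: the inverse of the primary-generator character modulo `v̄²`
(`(𝓞_K/v̄²)^× = {±1}` is hit by the units `±1`, and a unit `≡ 1 (mod v̄²)` is `1`).
[cite: IrelandRosen1982, Ch. 18 §4] [cite: Weil1956, §1] [cite: deShalit1987, II.1.9 (p. 43), II.4.12 (p. 66)] -/
theorem exists_char_type_neg_one [IsPrincipalIdealRing (𝓞 K)]
    {vbar : HeightOneSpectrum (𝓞 K)} (e : vbar.adicCompletionIntegers K ≃+* ℤ_[2])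
    {w₀ : InfinitePlace K} (hw₀ : ∀ w : InfinitePlace K, w = w₀) :
    ∃ φ₀ : HeckeCharacter K, φ₀.HasInfinityType (fun _ ↦ -1) (fun _ ↦ 0) ∧
      ∀ w : HeightOneSpectrum (𝓞 K), w ≠ vbar → φ₀.IsUnramifiedAt w := by
  have h𝔣 : vbar.asIdeal ^ 2 ≠ ⊥ := pow_ne_zero 2 vbar.ne_bot
  have hinj : ∀ u : (𝓞 K)ˣ, (u : 𝓞 K) - 1 ∈ vbar.asIdeal ^ 2 → u = 1 :=
    units_eq_one_of_sub_one_mem_sq e hw₀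
  obtain ⟨ψ, hψt, hψu⟩ := exists_heckeCharacter_primaryGen (exists_unit_mul_sub_one_mem_sq e) hinj h𝔣 w₀.embedding
  rw [embType_eq_of_forall_eq hw₀, embTypeConj_eq_of_forall_eq hw₀] at hψt
  refine ⟨ψ⁻¹, ?_, fun w hw ↦ (hψu w fun hle ↦ hw ?_).1.inv'⟩
  · have h := hψt.inv
    have e1 : (-fun _ ↦ (1 : ℤ) : InfinitePlace K → ℤ) = fun _ ↦ -1 := by funext w; simp
    have e2 : (-fun _ ↦ (0 : ℤ) : InfinitePlace K → ℤ) = fun _ ↦ 0 := by funext w; simp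
    rwa [e1, e2] at h
  · exact HeightOneSpectrum.ext (vbar.isMaximal.eq_of_le w.isPrime.ne_top (w.isPrime.le_of_pow_le hle)) |>.symm

end Summit.BirchSwinnertonDyer.BirchSwinnertonDyer.Theorems.PrintCf2.KatzJZeroUnique
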